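import Summits.QuantumFields.BalabanUV.Beta.EriceRemainderEnclosureHistoryAutonomyComparisonNonlinearVariationPrep

/-!
# EriceRemainderEnclosureHistoryAutonomyComparisonNonlinearSplitPrep — (E123a) THE DAMPING DEFECT OF A SPLIT EXCESS: routes (A) (modulus, (E118a)) and (D′) (variation,
# (E121a)) COMBINED for an excess `E = E₁ + E₂` with `E₁` SMOOTH (modulus `ME₁`) and `E₂` SMALL but of ANY steepness — the natural shape of a perturbation = smooth main
# part + rough small correction.  Base `B u = β₀ + Σ_{k<K} L_k·u_k` (`L_0 = 0`); functionals `B ≤ B₁ ≤ B′` on the box, `B₁ − B` and `B′ − B₁` isotone, `B₁ − B` of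
# modulus `ME₁`; `B′` with a modulus (family).  **`conf_incr_ge_split`**: within a configuration, `δ_k − δ_{k+1} ≤ (F(m) + ME₁·h_m³∕2 + e₂(m)·h_m²)·δ_k` given the
# variation bound for `e₂ = (B′ − B₁)(S′h)` at the deeper row — EXACTLY `δ_{k+1} − δ_k = X_m − PS′_B − PS′_{E₁} − PS′_{E₂}`, with `PS′_B ≤ Fδ` ((E121a) `pinSensB_le`),
# `PS′_{E₁} ≤ ME₁·h_m³δ∕2` (coupling gaps of two `B′`-solutions ≤ cube∕2 × pin gap), `PS′_{E₂} − X_m ≤ e₂(m)h_m²δ` (least-`J` pin comparison + discounted variation).  The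
# sequel (E123b) prices the two extras from the one spare twentieth: comparison whenever **`5·ME₁·γ + 10·sup E₂ ≤ β₀`** — uniting (E119d) (`E₂ = 0`) and (E121e) (`E₁ = 0`).

Cell `pub-balaban`, β-function sub-cell, BINDER row D4 «RemainderConst leaves for Bałaban's split» (`HOME/BINDER-OWNERS.md`; owner lineage `b2b-balaban-beta-an4`;
this file by co-owner #2 lineage `b2b-balaban-beta-d4-p2`, generation 99), β-FLOW TEAM duty (1), FREEZE (0) honoured (def-free; imports (E121a) and re-runs its
`conf_incr_ge_var` with the `E₁` part added; uses (E121a) `levels_facts` ∕ `pinSensB_le`, (E118a) `affine_facts`, (E119b) `excess_facts`, (E63a) `levelGap_le_pin_gap`,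
(E48a) `family_mem` ∕ `family_tail_eq` ∕ `le_of_pin_le` ∕ `strictAnti_of_memFlow`, node U2's `Sharpness.abs_sub_le_half_cube_mul` BY NAME; nothing restated).

HONEST FRAMING (page 1, verbatim and binding).  *"Discharging BetaPertH makes Bałaban's UV stability UNCONDITIONAL — a real constructive-QFT result; it is
NOT the continuum limit and NOT the Clay problem."*  THIS FILE DISCHARGES NOTHING OF THE KIND.  Elementary real analysis about ABSTRACT functionals on a box
]0,γ]^ℕ with displayed floors, moduli, profiles and signs — hypotheses of a census, not facts; the form, signs, ages and moments of Bałaban's (1.22) limit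
functional are NOT PRINTED ([I] p. 298; GAPS G-t4-U2-1∕-2) and NOT asserted.  Row D4 class UNCHANGED (critical-path width 0; instance 0∕1; D4 DISCHARGE NO
DATE).  HONEST DEPENDENCY: continuum YM on T⁴ ⇐ BetaPertH ∧ nine spine estimates (0/9 proved); BetaPertH ⇐ (D1) ∧ (D4) ∧ CAP+tail; G-an2-4 gates asym, D1
and NE2/3/4.  NOT CLAIMED here: the comparison theorem (sequel (E123b)); anything printed — NOT B12 Thm 2, NOT BetaPertH, NOT continuum, NOT Clay.

WHAT IS PROVED ([folklore]; 0 `def`, 0 sorry).  **`conf_incr_ge_split`**.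
-/

noncomputable section
open Finset Set

namespace Summit.QuantumFields.BalabanUV.Beta.EriceRemainderEnclosureHistoryAutonomyComparisonNonlinearSplitPrep

open Literature.MathematicalPhysics.QuantumFieldTheory.Balaban1983to89
open Literature.MathematicalPhysics.QuantumFieldTheory.Balaban1983to89.T4BetaStationary
open Literature.MathematicalPhysics.QuantumFieldTheory.Balaban1983to89.T4BetaFlowWellPosed
open Literature.MathematicalPhysics.QuantumFieldTheory.Balaban1983to89.T4BetaFlowWellPosed.Sharpness (abs_sub_le_half_cube_mul)
open Summit.QuantumFields.BalabanUV.Beta.EriceRemainderEnclosureHistoryAutonomyOrder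
  (family_mem family_tail_eq family_zero le_of_pin_le strictAnti_of_memFlow)
open Summit.QuantumFields.BalabanUV.Beta.EriceRemainderEnclosureHistoryAutonomyComparisonDropBound (levelGap_le_pin_gap)
open Summit.QuantumFields.BalabanUV.Beta.EriceRemainderEnclosureHistoryAutonomyComparisonNonlinearRowPrep (affine_facts)
open Summit.QuantumFields.BalabanUV.Beta.EriceRemainderEnclosureHistoryAutonomyComparisonNonlinearModulusPrep (excess_facts)
open Summit.QuantumFields.BalabanUV.Beta.EriceRemainderEnclosureHistoryAutonomyComparisonNonlinearVariationPrep (levels_facts pinSensB_le)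

variable {B B₁ B' : (ℕ → ℝ) → ℝ} {γ β₀ M' ME₁ : ℝ} {L : ℕ → ℝ} {K : ℕ} {S S' : ℝ → ℕ → ℝ}

/-! ## §1 The split defect -/

set_option maxHeartbeats 800000 in
/-- **THE DAMPING DEFECT OF A SPLIT EXCESS `E = E₁ + E₂` (smooth + small).**  Base affine (`L_0 = 0`); an intermediate functional `B ≤ B₁ ≤ B′` with `E₁ = B₁ − B`
isotone of modulus `ME₁` along ordered pairs and `E₂ = B′ − B₁` isotone (no modulus); base orbit `h = S y`, `e₂(i) = E₂(S′h_i)`; configuration `c` comparing, depth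
`k`, `m = c+1+k`, comparison from the pin `h_m`, and the variation bound for `e₂` at row `m` (`Σ_{j<J} h_{m+j}²·(e₂(m+j) − e₂(m+j+1)) ≤ X_m·h_m²` for every `J` —
implied by the one for the total excess).  Then `δ_k − δ_{k+1} ≤ (F(m) + ME₁·h_m³∕2 + e₂(m)·h_m²)·δ_k`: route (A) of (E118a) for `E₁` plus route (D′) of (E121a) for
`E₂` (`conf_incr_ge` is `B₁ = B′`, `conf_incr_ge_var` is `B₁ = B`). [folklore] -/
theorem conf_incr_ge_split (hBaff : ∀ u, SeqBox γ u → B u = β₀ + ∑ k ∈ range K, L k * u k) (hL : ∀ k, 0 ≤ L k) (hL0 : L 0 = 0) (hβ : 0 < β₀)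
    (hB' : ∀ u u' : ℕ → ℝ, SeqBox γ u → SeqBox γ u' → ∀ D : ℝ, (∀ j, |u j - u' j| ≤ D) → |B' u - B' u'| ≤ M' * D) (hM' : 0 ≤ M')
    (hexc1 : ∀ u, SeqBox γ u → B u ≤ B₁ u) (hexc2 : ∀ u, SeqBox γ u → B₁ u ≤ B' u)
    (hDmono1 : ∀ u v : ℕ → ℝ, SeqBox γ u → SeqBox γ v → (∀ j, u j ≤ v j) → B₁ u - B u ≤ B₁ v - B v)
    (hDmono2 : ∀ u v : ℕ → ℝ, SeqBox γ u → SeqBox γ v → (∀ j, u j ≤ v j) → B' u - B₁ u ≤ B' v - B₁ v)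
    (hEmod1 : ∀ u u' : ℕ → ℝ, SeqBox γ u → SeqBox γ u' → (∀ j, u' j ≤ u j) → ∀ D : ℝ, 0 ≤ D → (∀ j, u j - u' j ≤ D) →
      (B₁ u - B u) - (B₁ u' - B u') ≤ ME₁ * D) (hME1 : 0 ≤ ME₁)
    (hS : ∀ p, 0 < p → p ≤ γ → SeqBox γ (S p) ∧ MemFlow B p (S p))
    (huniq : ∀ p, 0 < p → p ≤ γ → ∀ u u' : ℕ → ℝ, SeqBox γ u → SeqBox γ u' → MemFlow B p u → MemFlow B p u' → u = u')
    (hS' : ∀ p, 0 < p → p ≤ γ → SeqBox γ (S' p) ∧ MemFlow B' p (S' p))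
    (huniq' : ∀ p, 0 < p → p ≤ γ → ∀ u u' : ℕ → ℝ, SeqBox γ u → SeqBox γ u' → MemFlow B' p u → MemFlow B' p u' → u = u')
    {y : ℝ} (hy : 0 < y) (hyγ : y ≤ γ) (c k : ℕ) (hcmpc : ∀ j, S' (S y c) j ≤ S y (c + j))
    (hcmpm : ∀ j, S' (S y (c + 1 + k)) j ≤ S y (c + 1 + k + j))
    (hV : ∀ J, ∑ j ∈ range J, S y (c + 1 + k + j) ^ 2
        * ((B' (S' (S y (c + 1 + k + j))) - B₁ (S' (S y (c + 1 + k + j)))) - (B' (S' (S y (c + 1 + k + j + 1))) - B₁ (S' (S y (c + 1 + k + j + 1)))))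
        ≤ (B' (S' (S y (c + 1 + k))) - B (S (S y (c + 1 + k)))) * S y (c + 1 + k) ^ 2) :
    (1 / S' (S y c) k ^ 2 - 1 / S y (c + k) ^ 2) - (1 / S' (S y c) (k + 1) ^ 2 - 1 / S y (c + k + 1) ^ 2)
      ≤ (∑ q ∈ Ico 1 K, L q * S y (c + 1 + k + q) ^ 3 / 2
          + ME₁ * S y (c + 1 + k) ^ 3 / 2 + (B' (S' (S y (c + 1 + k))) - B₁ (S' (S y (c + 1 + k)))) * S y (c + 1 + k) ^ 2)
          * (1 / S' (S y c) k ^ 2 - 1 / S y (c + k) ^ 2) := by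
  classical
  have hexc : ∀ u, SeqBox γ u → B u ≤ B' u := fun u hu => (hexc1 u hu).trans (hexc2 u hu)
  have hDmono : ∀ u v : ℕ → ℝ, SeqBox γ u → SeqBox γ v → (∀ j, u j ≤ v j) → B' u - B u ≤ B' v - B v := fun u v hu hv hle => by
    have := hDmono1 u v hu hv hle; have := hDmono2 u v hu hv hle; linarith
  obtain ⟨hmono', hlo'⟩ := excess_facts hBaff hL hβ hexc hDmono
  obtain ⟨hmono, hlo, _, _⟩ := affine_facts hBaff hL hβ
  have hqc := family_mem hS hy hyγ c
  have hqm := family_mem hS hy hyγ (c + 1 + k)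
  have hw := hS' _ hqc.1 hqc.2
  have hwk := family_mem hS' hqc.1 hqc.2 (k + 1)
  have hh := (hS y hy hyγ).1
  have hf := (hS y hy hyγ).2
  have hpos : ∀ j, 0 < S y j := fun j => (hh j).1
  have hanti := (strictAnti_of_memFlow hβ hlo hh hf).antitone
  -- notation
  set m : ℕ := c + 1 + k with hm_def
  set e : ℕ → ℝ := fun i => B' (S' (S y i)) - B₁ (S' (S y i)) with he_def
  set X : ℝ := B' (S' (S y m)) - B (S (S y m)) with hX_def
  set δk : ℝ := 1 / S' (S y c) k ^ 2 - 1 / S y (c + k) ^ 2 with hδk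
  set δ' : ℝ := 1 / S' (S y c) (k + 1) ^ 2 - 1 / S y (c + k + 1) ^ 2 with hδ'
  set F : ℝ := ∑ q ∈ Ico 1 K, L q * S y (m + q) ^ 3 / 2 with hF
  have he0 : ∀ i, 0 ≤ e i := fun i => by simp only [he_def]; linarith [hexc2 _ (hS' _ (family_mem hS hy hyγ i).1 (family_mem hS hy hyγ i).2).1]
  have heanti : ∀ i, e (i + 1) ≤ e i := fun i => by
    have hq := family_mem hS hy hyγ i
    have hq1 := family_mem hS hy hyγ (i + 1)
    have hpin : S y (i + 1) ≤ S y i := hanti (Nat.le_succ i)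
    have hk0 := hS' _ hq.1 hq.2
    have hk1 := hS' _ hq1.1 hq1.2
    have hle : ∀ j, S' (S y (i + 1)) j ≤ S' (S y i) j := fun j => le_of_pin_le hβ hB' hM' hlo' huniq' hq1.1 hpin hq.2 hk1.1 hk0.1 hk1.2 hk0.2 j
    simp only [he_def]; exact hDmono2 _ _ hk1.1 hk0.1 hle
  have heanti' : ∀ i j, e (i + j) ≤ e i := by
    intro i j
    induction j with
    | zero => simp
    | succ j ih => rw [show i + (j + 1) = i + j + 1 by ring]; exact (heanti (i + j)).trans ih
  have hF0 : 0 ≤ F := sum_nonneg fun q _ => by have := hL q; have := hpos (m + q); positivity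
  have hδk0 : 0 ≤ δk := sub_nonneg.mpr (one_div_le_one_div_of_le (pow_pos (family_mem hS' hqc.1 hqc.2 k).1 2)
    (pow_le_pow_left₀ (family_mem hS' hqc.1 hqc.2 k).1.le (hcmpc k) 2))
  -- the increment identity: δ′ = δ_k + X − (Φ′(h_m) − Φ′(h″_{k+1}))
  have e1 : 1 / S' (S y c) (k + 1) ^ 2 = 1 / S' (S y c) k ^ 2 + B' (S' (S' (S y c) (k + 1))) := by
    rw [← family_tail_eq hS' huniq' hqc.1 hqc.2 (k + 1), hw.2.2 k]
  have e2 : 1 / S y (c + k + 1) ^ 2 = 1 / S y (c + k) ^ 2 + B (S (S y m)) := by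
    rw [hm_def, ← family_tail_eq hS huniq hy hyγ (c + 1 + k), hf.2 (c + k), show c + k + 1 = c + 1 + k by ring]
  -- the two pins h″_{k+1} ≤ h_m, level gap δ′
  have hq'q : S' (S y c) (k + 1) ≤ S y m := by have := hcmpc (k + 1); rwa [show c + (k + 1) = c + 1 + k by ring] at this
  have hgap' : 1 / S' (S y c) (k + 1) ^ 2 - 1 / S y m ^ 2 = δ' := by rw [hδ', hm_def, show c + 1 + k = c + k + 1 by ring]
  have hδ'0 : 0 ≤ δ' := by
    rw [← hgap']; exact sub_nonneg.mpr (one_div_le_one_div_of_le (pow_pos hwk.1 2) (pow_le_pow_left₀ hwk.1.le hq'q 2))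
  -- the B-part of the pin sensitivity
  have etail : ∀ q, S y (m + q) = S (S y m) q := fun q => congrFun (family_tail_eq hS huniq hy hyγ m) q
  have hcmpm' : ∀ j, S' (S y m) j ≤ S (S y m) j := fun j => by rw [← etail j]; exact hcmpm j
  have hpsB := pinSensB_le hBaff hL hL0 hmono' hβ hB' hM' hlo' hS' huniq' hwk.1 hq'q hqm.2 hcmpm'
  simp only [← etail] at hpsB
  rw [hgap'] at hpsB
  -- the excess part: ẽ ≥ e_{m+J} for the least J with a_{m+J} ≥ a_m + δ′
  have hexJ : ∃ J : ℕ, 1 / S y m ^ 2 + δ' ≤ 1 / S y (m + J) ^ 2 := by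
    obtain ⟨J, hJ⟩ := exists_nat_ge (δ' / β₀)
    refine ⟨J, le_trans ?_ (levels_facts hlo hh hf m J)⟩
    have : δ' ≤ (J : ℝ) * β₀ := by rw [div_le_iff₀ hβ] at hJ; linarith
    linarith
  set J : ℕ := Nat.find hexJ with hJ_def
  have hJ : 1 / S y m ^ 2 + δ' ≤ 1 / S y (m + J) ^ 2 := Nat.find_spec hexJ
  have hJmin : ∀ j, j < J → 1 / S y (m + j) ^ 2 < 1 / S y m ^ 2 + δ' := fun j hj => lt_of_not_ge (Nat.find_min hexJ hj)
  -- h″_{k+1} ≥ h_{m+J}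
  have hzJ := family_mem hS hy hyγ (m + J)
  have hpin : S y (m + J) ≤ S' (S y c) (k + 1) := by
    have h1 : 1 / S' (S y c) (k + 1) ^ 2 ≤ 1 / S y (m + J) ^ 2 := by rw [← hgap'] at hJ; linarith
    have h2 := (one_div_le_one_div (pow_pos hwk.1 2) (pow_pos hzJ.1 2)).mp h1
    exact (pow_le_pow_iff_left₀ hzJ.1.le hwk.1.le two_ne_zero).mp h2
  have hkJ := hS' _ hzJ.1 hzJ.2
  have hkw := hS' _ hwk.1 hwk.2
  have hleJ : ∀ j, S' (S y (m + J)) j ≤ S' (S' (S y c) (k + 1)) j := fun j =>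
    le_of_pin_le hβ hB' hM' hlo' huniq' hzJ.1 hpin hwk.2 hkJ.1 hkw.1 hkJ.2 hkw.2 j
  have hEJ : e (m + J) ≤ B' (S' (S' (S y c) (k + 1))) - B₁ (S' (S' (S y c) (k + 1))) := by
    simp only [he_def]; exact hDmono2 _ _ hkJ.1 hkw.1 hleJ
  -- the E₁ part: modulus × coupling gap, the coupling gaps of the two B′-solutions being ≤ h_m³∕2 · δ′
  have hkm := hS' _ hqm.1 hqm.2
  have hlew : ∀ j, S' (S' (S y c) (k + 1)) j ≤ S' (S y m) j := fun j =>
    le_of_pin_le hβ hB' hM' hlo' huniq' hwk.1 hq'q hqm.2 hkw.1 hkm.1 hkw.2 hkm.2 j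
  have hlg : ∀ j, 1 / S' (S' (S y c) (k + 1)) j ^ 2 - 1 / S' (S y m) j ^ 2 ≤ δ' := by
    intro j; have := levelGap_le_pin_gap hmono' hkm.1 hkm.2 hkw.1 hkw.2 hlew j; rw [hgap'] at this; exact this
  have hpinm : ∀ j, S' (S y m) j ≤ S y m := fun j => by
    have := (strictAnti_of_memFlow hβ hlo' hkm.1 hkm.2).antitone (Nat.zero_le j); rwa [hkm.2.1] at this
  have hgapw : ∀ j, S' (S y m) j - S' (S' (S y c) (k + 1)) j ≤ S y m ^ 3 / 2 * δ' := by
    intro j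
    have h1 := (hkm.1 j).1; have h2 := (hkw.1 j).1
    have hw := abs_sub_le_half_cube_mul h1 h2 le_rfl (hlew j)
    have hg0 : 0 ≤ S' (S y m) j - S' (S' (S y c) (k + 1)) j := by linarith [hlew j]
    have hd0 : 0 ≤ 1 / S' (S' (S y c) (k + 1)) j ^ 2 - 1 / S' (S y m) j ^ 2 :=
      sub_nonneg.mpr (one_div_le_one_div_of_le (pow_pos h2 2) (pow_le_pow_left₀ h2.le (hlew j) 2))
    rw [abs_of_nonneg hg0, abs_sub_comm, abs_of_nonneg hd0] at hw
    have h3 : S' (S y m) j ^ 3 ≤ S y m ^ 3 := pow_le_pow_left₀ h1.le (hpinm j) 3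
    calc S' (S y m) j - S' (S' (S y c) (k + 1)) j ≤ S' (S y m) j ^ 3 / 2 * (1 / S' (S' (S y c) (k + 1)) j ^ 2 - 1 / S' (S y m) j ^ 2) := hw
      _ ≤ S' (S y m) j ^ 3 / 2 * δ' := mul_le_mul_of_nonneg_left (hlg j) (by positivity)
      _ ≤ S y m ^ 3 / 2 * δ' := mul_le_mul_of_nonneg_right (by linarith) hδ'0
  have hE1 : (B₁ (S' (S y m)) - B (S' (S y m))) - (B₁ (S' (S' (S y c) (k + 1))) - B (S' (S' (S y c) (k + 1))))
      ≤ ME₁ * (S y m ^ 3 / 2 * δ') := hEmod1 _ _ hkm.1 hkw.1 hlew _ (mul_nonneg (by have := hpos m; positivity) hδ'0) hgapw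
  -- telescoping: e_m − e_{m+J} = Σ_{j<J} Δe_{m+j}
  have htel : ∀ J' : ℕ, ∑ j ∈ range J', (e (m + j) - e (m + j + 1)) = e m - e (m + J') := by
    intro J'
    induction J' with
    | zero => simp
    | succ J' ih => rw [sum_range_succ, ih, show m + (J' + 1) = m + J' + 1 by ring]; ring
  -- the surplus: (e_m − e_{m+J}) − X ≤ h_m² δ′ (e_m − e_{m+J}) ≤ h_m² δ′ e_m
  have hVJ := hV J
  have hm2 : 0 < S y m ^ 2 := pow_pos (hpos m) 2
  have hterm : ∀ j ∈ range J, (S y m ^ 2 - S y (m + j) ^ 2) * (e (m + j) - e (m + j + 1))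
      ≤ S y m ^ 2 * (S y m ^ 2 * δ') * (e (m + j) - e (m + j + 1)) := by
    intro j hj
    have hjJ := hJmin j (mem_range.mp hj)
    have hΔ0 : 0 ≤ e (m + j) - e (m + j + 1) := by linarith [heanti (m + j)]
    refine mul_le_mul_of_nonneg_right ?_ hΔ0
    have hpj := hpos (m + j)
    have hpj2 : 0 < S y (m + j) ^ 2 := pow_pos hpj 2
    -- h_m² − h_{m+j}² = h_m² h_{m+j}² (a_{m+j} − a_m) ≤ h_m² h_{m+j}² δ′ ≤ h_m² h_m² δ′
    have hc1 : S y (m + j) ^ 2 * (1 / S y (m + j) ^ 2) = 1 := mul_one_div_cancel hpj2.ne'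
    have hc2 : S y m ^ 2 * (1 / S y m ^ 2) = 1 := mul_one_div_cancel hm2.ne'
    have hid : S y m ^ 2 - S y (m + j) ^ 2 = S y m ^ 2 * S y (m + j) ^ 2 * (1 / S y (m + j) ^ 2 - 1 / S y m ^ 2) := by
      linear_combination (-(S y m ^ 2)) * hc1 + (S y (m + j) ^ 2) * hc2
    rw [hid]
    have hlt : 1 / S y (m + j) ^ 2 - 1 / S y m ^ 2 ≤ δ' := by linarith
    have hsq : S y (m + j) ^ 2 ≤ S y m ^ 2 := pow_le_pow_left₀ hpj.le (hanti (by omega)) 2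
    calc S y m ^ 2 * S y (m + j) ^ 2 * (1 / S y (m + j) ^ 2 - 1 / S y m ^ 2)
        ≤ S y m ^ 2 * S y (m + j) ^ 2 * δ' := mul_le_mul_of_nonneg_left hlt (by positivity)
      _ ≤ S y m ^ 2 * S y m ^ 2 * δ' := mul_le_mul_of_nonneg_right (mul_le_mul_of_nonneg_left hsq hm2.le) hδ'0
      _ = S y m ^ 2 * (S y m ^ 2 * δ') := by ring
  have hsur : S y m ^ 2 * ((e m - e (m + J)) - X) ≤ S y m ^ 2 * (S y m ^ 2 * δ' * (e m - e (m + J))) := by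
    have h1 := sum_le_sum hterm
    have e3 : ∑ j ∈ range J, (S y m ^ 2 - S y (m + j) ^ 2) * (e (m + j) - e (m + j + 1))
        = S y m ^ 2 * ∑ j ∈ range J, (e (m + j) - e (m + j + 1)) - ∑ j ∈ range J, S y (m + j) ^ 2 * (e (m + j) - e (m + j + 1)) := by
      rw [mul_sum, ← sum_sub_distrib]; exact sum_congr rfl fun j _ => by ring
    have e4 : ∑ j ∈ range J, S y m ^ 2 * (S y m ^ 2 * δ') * (e (m + j) - e (m + j + 1))
        = S y m ^ 2 * (S y m ^ 2 * δ' * ∑ j ∈ range J, (e (m + j) - e (m + j + 1))) := by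
      rw [mul_sum, mul_sum]; exact sum_congr rfl fun j _ => by ring
    rw [e3, e4, htel J] at h1
    have hV' : ∑ j ∈ range J, S y (m + j) ^ 2 * (e (m + j) - e (m + j + 1)) ≤ X * S y m ^ 2 := by
      have := hVJ; simp only [he_def, hX_def, hm_def] at this ⊢; exact this
    nlinarith [hV']
  have hsur' : (e m - e (m + J)) - X ≤ S y m ^ 2 * δ' * e m := by
    have h1 : (e m - e (m + J)) - X ≤ S y m ^ 2 * δ' * (e m - e (m + J)) := le_of_mul_le_mul_left hsur hm2
    have h2 : S y m ^ 2 * δ' * (e m - e (m + J)) ≤ S y m ^ 2 * δ' * e m := by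
      apply mul_le_mul_of_nonneg_left _ (by positivity); linarith [he0 (m + J)]
    exact h1.trans h2
  -- assemble: ε = X − PS′_B − PS′_{E₁} − PS′_{E₂} ≥ −(F + ME₁h_m³∕2 + e_m h_m²) δ′
  set θ : ℝ := F + ME₁ * S y m ^ 3 / 2 + e m * S y m ^ 2 with hθ
  have hθ0 : 0 ≤ θ := add_nonneg (add_nonneg hF0 (by have := hpos m; positivity)) (mul_nonneg (he0 m) hm2.le)
  set ε : ℝ := δ' - δk with hε
  have key : ε = X - (B (S' (S y m)) - B (S' (S' (S y c) (k + 1))))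
      - ((B₁ (S' (S y m)) - B (S' (S y m))) - (B₁ (S' (S' (S y c) (k + 1))) - B (S' (S' (S y c) (k + 1)))))
      - (e m - (B' (S' (S' (S y c) (k + 1))) - B₁ (S' (S' (S y c) (k + 1))))) := by
    simp only [hε, hδ', hδk, hX_def, he_def]; rw [e1, e2]; ring
  have h1 : -(θ * δ') ≤ ε := by
    rw [key, hθ]
    have hpe : e m - (B' (S' (S' (S y c) (k + 1))) - B₁ (S' (S' (S y c) (k + 1)))) ≤ e m - e (m + J) := by linarith
    nlinarith [hpsB, hsur', hpe, hF0, hδ'0, hE1]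
  have goal : δk - δ' ≤ θ * δk := by
    have hε' : δ' = δk + ε := by rw [hε]; ring
    rw [hε'] at h1 ⊢
    by_cases hε0 : 0 ≤ ε
    · nlinarith
    · have hε0 := lt_of_not_ge hε0; nlinarith
  simpa [hθ, hF, hm_def] using goal

end Summit.QuantumFields.BalabanUV.Beta.EriceRemainderEnclosureHistoryAutonomyComparisonNonlinearSplitPrep

end
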